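import Literature.MathematicalPhysics.QuantumFieldTheory.ConformalBootstrap3D.MixedBlockCoefficients
import Mathlib.Tactic.Linarith
import Mathlib.Tactic.Ring
import Mathlib.Tactic.Positivity
import HarnessLib

/-!
# Sign structure of the `⟨σεσε⟩`-type coefficients and their exact relation to the `⟨εσσε⟩`-type ones

Corollaries of the Dolan–Osborn factorisation `hrCoeffAB_mul_doPochFactor` (Dolan–Osborn 2004 §3 eq. (3.11),
`MixedBlockCoefficients.lean`) needed by certificates for the sign-INDEFINITE mixed family `a = -b`
(`gmm = g^{Δ_σε,Δ_σε}` of sum rule 3):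

* `hrCoeffAB_mul_doPochFactor_swap` — for any two parameter pairs, `A(a,b)·Π_{a'b'} · Π₀₀ = A(a',b')·Π_{ab} · Π₀₀`,
  hence (`Π₀₀ ≠ 0`) `A_{n,j}(a,b) Π_{a'b'}(n,j) = Π_{ab}(n,j) A_{n,j}(a',b')` (`hrCoeffAB_mul_doPochFactor_eq_of_ne`):
  in particular the `⟨σεσε⟩` array is the `⟨εσσε⟩` array of the SAME operator times the explicit rational
  function `Π_{c,-c}/Π_{-c,-c} = ∏_{i<m}(λ₁+i+c)/(λ₁+i-c) · ∏_{i<n'}(λ₂-½+i+c)/(λ₂-½+i-c)` wherever the latter's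
  denominator is non-zero (pub-ising3d AXIOMS-SOURCES R8′);
* `hrCoeffAB_neg_mul_doPochFactor_nonneg` — **the sign pattern**: strictly above the unitarity bound (and
  `Δ ≠ 1` if `ℓ = 0`), `A_{n,j}(a,-a) · Π_{a,-a}(n,j) ≥ 0`, i.e. wherever `A_{n,j}(a,-a) ≠ 0` its sign is that of
  `Π_{a,-a}(n,j) = ∏_{i<m}((λ₁+i)²-a²) ∏_{i<n'}((λ₂-½+i)²-a²)` — finitely many negative factors, explicit in
  `(Δ, ℓ, a)` (AXIOMS-SOURCES S8.3).

Elementary algebra on landed results; no analysis. [cite: DolanOsborn2004, §3 eq. (3.11)]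
-/

namespace Literature.MathematicalPhysics.QuantumFieldTheory.ConformalBootstrap3D

/-- Cross relation between two parameter pairs (both compared with `(0,0)` through eq. (3.11)):
`A(a,b) Π_{a'b'} Π₀₀ = A(a',b') Π_{ab} Π₀₀`. [cite: DolanOsborn2004, §3 eq. (3.11)] -/
theorem hrCoeffAB_mul_doPochFactor_swap (a b a' b' Δ : ℝ) (ℓ n j : ℕ) :
    hrCoeffAB a b Δ ℓ n j * doPochFactor a' b' Δ ℓ n j * doPochFactor 0 0 Δ ℓ n j =
      hrCoeffAB a' b' Δ ℓ n j * doPochFactor a b Δ ℓ n j * doPochFactor 0 0 Δ ℓ n j := by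
  have h1 := hrCoeffAB_mul_doPochFactor a b Δ ℓ n j
  have h2 := hrCoeffAB_mul_doPochFactor a' b' Δ ℓ n j
  linear_combination doPochFactor a' b' Δ ℓ n j * h1 - doPochFactor a b Δ ℓ n j * h2

/-- The same, with `Π₀₀ ≠ 0` cancelled: `A_{n,j}(a,b) Π_{a'b'}(n,j) = Π_{ab}(n,j) A_{n,j}(a',b')`. With
`(a,b) = (c,-c)` and `(a',b') = (-c,-c)`: the `⟨σεσε⟩` coefficient is the `⟨εσσε⟩` coefficient of the same
operator times `Π_{c,-c}/Π_{-c,-c}` (where the latter is non-zero). [cite: DolanOsborn2004, §3 eq. (3.11)] -/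
theorem hrCoeffAB_mul_doPochFactor_eq_of_ne {a b a' b' Δ : ℝ} {ℓ n j : ℕ}
    (h : doPochFactor 0 0 Δ ℓ n j ≠ 0) :
    hrCoeffAB a b Δ ℓ n j * doPochFactor a' b' Δ ℓ n j =
      doPochFactor a b Δ ℓ n j * hrCoeffAB a' b' Δ ℓ n j := by
  have := hrCoeffAB_mul_doPochFactor_swap a b a' b' Δ ℓ n j
  have h2 : (hrCoeffAB a b Δ ℓ n j * doPochFactor a' b' Δ ℓ n j -
      doPochFactor a b Δ ℓ n j * hrCoeffAB a' b' Δ ℓ n j) * doPochFactor 0 0 Δ ℓ n j = 0 := by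
    linear_combination this
  rcases mul_eq_zero.mp h2 with h0 | h0
  · linarith
  · exact absurd h0 h

/-- **Sign pattern of the `a = -b` coefficients.** Strictly above the unitarity bound (and `Δ ≠ 1` when
`ℓ = 0`): `A_{n,j}(a,-a) · Π_{a,-a}(n,j) ≥ 0` — the coefficient has the sign of the explicit product
`∏_{i<m}((λ₁+i)²-a²) ∏_{i<n'}((λ₂-½+i)²-a²)` wherever it is non-zero. Proof: multiply eq. (3.11)
`A(a,-a) Π₀₀ = Π_{a,-a} A(0,0)` by `Π_{a,-a}` and use `A(0,0) ≥ 0`, `Π₀₀ > 0`. [cite: DolanOsborn2004, §3 eq. (3.11)] -/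
theorem hrCoeffAB_neg_mul_doPochFactor_nonneg {Δ : ℝ} {ℓ : ℕ} (a : ℝ) (hΔ : unitarityBound3D ℓ < Δ)
    (h1 : ℓ = 0 → Δ ≠ 1) (n j : ℕ) :
    0 ≤ hrCoeffAB a (-a) Δ ℓ n j * doPochFactor a (-a) Δ ℓ n j := by
  have hP := doPochFactor_zero_zero_pos hΔ h1 n j
  have hA := hrCoeff_nonneg hΔ n j
  have key := hrCoeffAB_mul_doPochFactor a (-a) Δ ℓ n j
  -- `(A(a,-a) Π_{a,-a}) Π₀₀ = Π_{a,-a}² A(0,0) ≥ 0`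
  have h2 : (hrCoeffAB a (-a) Δ ℓ n j * doPochFactor a (-a) Δ ℓ n j) * doPochFactor 0 0 Δ ℓ n j =
      doPochFactor a (-a) Δ ℓ n j ^ 2 * hrCoeff Δ ℓ n j := by
    linear_combination doPochFactor a (-a) Δ ℓ n j * key
  have h3 : 0 ≤ (hrCoeffAB a (-a) Δ ℓ n j * doPochFactor a (-a) Δ ℓ n j) * doPochFactor 0 0 Δ ℓ n j := by
    rw [h2]; positivity
  exact nonneg_of_mul_nonneg_left h3 hP

/-- Equivalently: where `Π_{a,-a}(n,j) > 0` the coefficient is `≥ 0`, and where `Π_{a,-a}(n,j) < 0` it is `≤ 0`.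
[cite: DolanOsborn2004, §3 eq. (3.11)] -/
theorem hrCoeffAB_neg_nonneg_of_doPochFactor_pos {Δ : ℝ} {ℓ : ℕ} (a : ℝ) (hΔ : unitarityBound3D ℓ < Δ)
    (h1 : ℓ = 0 → Δ ≠ 1) {n j : ℕ} (hpos : 0 < doPochFactor a (-a) Δ ℓ n j) :
    0 ≤ hrCoeffAB a (-a) Δ ℓ n j :=
  nonneg_of_mul_nonneg_left (hrCoeffAB_neg_mul_doPochFactor_nonneg a hΔ h1 n j) hpos

/-- See `hrCoeffAB_neg_nonneg_of_doPochFactor_pos`. [cite: DolanOsborn2004, §3 eq. (3.11)] -/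
theorem hrCoeffAB_neg_nonpos_of_doPochFactor_neg {Δ : ℝ} {ℓ : ℕ} (a : ℝ) (hΔ : unitarityBound3D ℓ < Δ)
    (h1 : ℓ = 0 → Δ ≠ 1) {n j : ℕ} (hneg : doPochFactor a (-a) Δ ℓ n j < 0) :
    hrCoeffAB a (-a) Δ ℓ n j ≤ 0 := by
  have h := hrCoeffAB_neg_mul_doPochFactor_nonneg a hΔ h1 n j
  by_contra hc
  have hc' : 0 < hrCoeffAB a (-a) Δ ℓ n j := lt_of_not_ge hc
  have : hrCoeffAB a (-a) Δ ℓ n j * doPochFactor a (-a) Δ ℓ n j < 0 := mul_neg_of_pos_of_neg hc' hneg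
  linarith

end Literature.MathematicalPhysics.QuantumFieldTheory.ConformalBootstrap3D
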